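import Literature.MathematicalPhysics.QuantumFieldTheory.Balaban1983to89.Beta.CombesThomasForm

/-!
# NE7K1LinSchurLineForm — row NE7 (node U5), candidate route HOM, path H1L, cell K1-lin(s): the FORM (Agmon ∕ weighted-ℓ²)
# version of the interpolated-Schur propagator line — coercivity AND the Combes–Thomas CONJUGATION ERROR of the
# √s-extended operator are convex-stable, so the tree's form estimate `Beta.CombesThomasForm.combesThomas_form` gives
# `|G(s)(x,y)| ≤ (2∕σ)·e^{−(ρ_x − ρ_y)}` for EVERY admissible weight `ρ`, UNIFORMLY IN `s ∈ [0,1]` (real matrices)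

Lineage `b2b-balaban-t4-ne7-p2` (CRUX PROVER NE7 #2), generation 63; sibling of `Support/NE7K1LinSchurLine` (the entrywise
∕ accretive version over `ℂ` via `Literature.Analysis.Matrix.accretive_combes_thomas`; proposal p284751), written because
that version's decay rate is ONE-SCALE (`θ ≍ gap∕bandwidth`), whereas the tree's `η`-UNIFORM decay certificates for
Bałaban's operators (`Balaban1983to89.B4Lower18` for [Balaban1983RegularityDecay] (1.6)∕(1.8) at `A = 0`,
`Beta.CombesThomasFormOp.setDecay_lattice`) run on the FORM version `Beta.CombesThomasForm.combesThomas_form`, whose two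
hypotheses are a coercivity floor `σ‖ω‖² ≤ ⟨ω, Hω⟩` and a conjugation-error bound `−(σ∕2)‖w‖² ≤ Σ_{jk}(e^{ρ_j−ρ_k} − 1)H_{jk}w_jw_k`
for a weight `ρ`.  THIS FILE shows BOTH hypotheses pass from the endpoints `P₀`, `H₁ = [[A₁,B],[C,D]]` to the √s-extended
operator `𝒫(s) = [[(1−s)P₀ + sA₁, √s·B],[√s·C, D]]` for every `s ∈ [0,1]` with the SAME `σ` and the SAME weight (the
weight commutes with the `√s` rescaling), by the BILINEAR form identity
`⟨w′, 𝒫(s)w⟩ = (1−s)·⟨a′, P₀a⟩ + ⟨(√s·a′, φ′), H₁(√s·a, φ)⟩` (`form₂_extOpR`): `coercive_extOpR`, `conjError_extOpR_ge`.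
With the block inverse (`inv_extOpR_inl_inl`: `G(s) = P(s)⁻¹` is the coarse–coarse block of `𝒫(s)⁻¹`, the Schur complement
of `𝒫(s)` over the fine block being EXACTLY `P(s) = (1−s)P₀ + s(A₁ − BD⁻¹C)`, `schur_extOpR`) the tree's `combesThomas_form`
yields **`lineOpR_inv_decay_form`**: `|G(s)(x,y)| ≤ (2∕σ)·e^{−(ρ(inl x) − ρ(inl y))}` for every `s ∈ [0,1]` — every constant
and the weight class `s`-FREE; instantiated with `Beta.CombesThomasForm`'s lattice defect lemmas (`conjError_lap_ge`,
`conjError_blocks_ge`) the admissible weights are `δ`-Lipschitz in PHYSICAL distance with `δ` independent of the mesh —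
the (1.10)-type `η`-uniform rate, now uniform in `s` as well.

HONEST FRAMING (page 1): FIXED FINITE T⁴, rung (B)+1, CONDITIONAL on BetaPertH and the nine spine estimates (0/9 proved);
NOT infinite volume, NOT a mass gap, NOT the Clay problem; NE7 NOT PRINTED ∕ NOT PROVED.  Everything below is [folklore]
linear algebra over abstract finite index sets (real matrices); 0 Bałaban letters; nothing printed asserted; no cite tag
is a hypothesis; no `sorry`.  WHAT IT DOES NOT DO: type `P₀`, `H₁` for Bałaban's operators (typing licence of
`YM-SURGE-PLAN.md` row X-A7; at `A = 0` the tree's `B4Lower18.fineOpR` is the candidate `P₀` and, one format finer and in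
block coordinates, `H₁`); supply the weights (the instantiator's metric facts, as in `CombesThomasFormOp` §5); treat the
`L^∞`-regularity half of (1.10) or complex `s`.  NOT NE7 (spine 0/9 unchanged), NOT summit progress.  HONEST DEPENDENCY:
continuum YM on T⁴ ⇐ BetaPertH ∧ nine spine estimates (0/9 proved); BetaPertH ⇐ (D1) ∧ (D4) ∧ CAP+tail; G-an2-4 gates asym,
D1 and NE2/3/4.
-/

noncomputable section

open Finset Matrix

namespace Summit.QuantumFields.BalabanUV.T4Continuum.NE7K1LinSchurLineForm

variable {ιc ιf : Type*}

/-! ### §1 The real line and its √s-extension -/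

/-- The √s-extended real operator `𝒫(s) = [[(1−s)P₀ + sA₁, √s·B],[√s·C, D]]` on coarse ⊕ fine. [folklore] -/
def extOpR (P₀ A₁ : Matrix ιc ιc ℝ) (B : Matrix ιc ιf ℝ) (C : Matrix ιf ιc ℝ) (D : Matrix ιf ιf ℝ) (s : ℝ) :
    Matrix (ιc ⊕ ιf) (ιc ⊕ ιf) ℝ :=
  fromBlocks ((1 - s) • P₀ + s • A₁) (Real.sqrt s • B) (Real.sqrt s • C) D

/-- The rescaled test vector `(√s·a, φ)`. [folklore] -/
def uvecR (s : ℝ) (w : ιc ⊕ ιf → ℝ) : ιc ⊕ ιf → ℝ :=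
  Sum.elim (Real.sqrt s • (w ∘ Sum.inl)) (w ∘ Sum.inr)

section Line

variable [Fintype ιf] [DecidableEq ιf]

/-- The real interpolated line `P(s) = (1−s)P₀ + s(A₁ − B·D⁻¹·C)`. [folklore] -/
def lineOpR (P₀ A₁ : Matrix ιc ιc ℝ) (B : Matrix ιc ιf ℝ) (C : Matrix ιf ιc ℝ) (D : Matrix ιf ιf ℝ) (s : ℝ) :
    Matrix ιc ιc ℝ :=
  (1 - s) • P₀ + s • (A₁ - B * D⁻¹ * C)

/-- **The Schur complement of `𝒫(s)` over the fine block IS the line** (`0 ≤ s`, `√s·√s = s`). [folklore] -/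
theorem schur_extOpR (P₀ A₁ : Matrix ιc ιc ℝ) (B : Matrix ιc ιf ℝ) (C : Matrix ιf ιc ℝ) (D : Matrix ιf ιf ℝ)
    {s : ℝ} (hs : 0 ≤ s) :
    ((1 - s) • P₀ + s • A₁) - (Real.sqrt s • B) * D⁻¹ * (Real.sqrt s • C) = lineOpR P₀ A₁ B C D s := by
  simp only [lineOpR, Matrix.smul_mul, Matrix.mul_smul, smul_smul, Real.mul_self_sqrt hs, smul_sub]
  abel

end Line

variable (P₀ A₁ : Matrix ιc ιc ℝ) (B : Matrix ιc ιf ℝ) (C : Matrix ιf ιc ℝ) (D : Matrix ιf ιf ℝ)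

/-! ### §2 The BILINEAR form identity; coercivity and conjugation error are convex-stable -/

section Form

variable [Fintype ιc] [Fintype ιf]

/-- **BILINEAR FORM IDENTITY**: `⟨w′, 𝒫(s)w⟩ = (1−s)·⟨a′, P₀a⟩ + ⟨(√s·a′, φ′), H₁(√s·a, φ)⟩` (`0 ≤ s`). [folklore] -/
theorem form₂_extOpR {s : ℝ} (hs : 0 ≤ s) (w' w : ιc ⊕ ιf → ℝ) :
    w' ⬝ᵥ (extOpR P₀ A₁ B C D s).mulVec w =
      (1 - s) * ((w' ∘ Sum.inl) ⬝ᵥ P₀.mulVec (w ∘ Sum.inl)) +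
        uvecR s w' ⬝ᵥ (fromBlocks A₁ B C D).mulVec (uvecR s w) := by
  have hss : Real.sqrt s * Real.sqrt s = s := Real.mul_self_sqrt hs
  simp only [extOpR, uvecR, dotProduct, fromBlocks_mulVec, Fintype.sum_sum_type, Sum.elim_inl, Sum.elim_inr,
    Sum.elim_comp_inl, Sum.elim_comp_inr, add_mulVec, smul_mulVec, mulVec_smul, Pi.add_apply, Pi.smul_apply,
    smul_eq_mul, Function.comp_apply]
  rw [Finset.mul_sum, ← add_assoc]
  congr 1
  rw [← Finset.sum_add_distrib]
  refine Finset.sum_congr rfl fun c _ => ?_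
  linear_combination (-(w' (Sum.inl c) * (A₁ *ᵥ (w ∘ Sum.inl)) c)) * hss

/-- `‖(√s·a, φ)‖² = s‖a‖² + ‖φ‖²` (`0 ≤ s`). [folklore] -/
theorem uvecR_dot_self {s : ℝ} (hs : 0 ≤ s) (w : ιc ⊕ ιf → ℝ) :
    uvecR s w ⬝ᵥ uvecR s w = s * ((w ∘ Sum.inl) ⬝ᵥ (w ∘ Sum.inl)) + (w ∘ Sum.inr) ⬝ᵥ (w ∘ Sum.inr) := by
  have hss : Real.sqrt s * Real.sqrt s = s := Real.mul_self_sqrt hs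
  simp only [uvecR, dotProduct, Fintype.sum_sum_type, Sum.elim_inl, Sum.elim_inr, Pi.smul_apply, smul_eq_mul,
    Finset.mul_sum]
  congr 1
  refine Finset.sum_congr rfl fun c _ => ?_
  linear_combination ((w ∘ Sum.inl) c * (w ∘ Sum.inl) c) * hss

omit [Fintype ιf] in
/-- `‖w‖² = ‖a‖² + ‖φ‖²` on coarse ⊕ fine. [folklore] -/
theorem dot_self_sum [Fintype ιf] (w : ιc ⊕ ιf → ℝ) :
    w ⬝ᵥ w = (w ∘ Sum.inl) ⬝ᵥ (w ∘ Sum.inl) + (w ∘ Sum.inr) ⬝ᵥ (w ∘ Sum.inr) := by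
  simp only [dotProduct, Fintype.sum_sum_type, Function.comp_apply]

/-- **UNIFORM COERCIVITY**: `σ‖a‖² ≤ ⟨a,P₀a⟩` and `σ‖u‖² ≤ ⟨u,H₁u⟩` (`0 ≤ σ`) ⇒ `σ‖w‖² ≤ ⟨w,𝒫(s)w⟩` for every
`s ∈ [0,1]` — the SAME `σ` (any sign), no sign relation between `P₀` and the Schur endpoint; in fact
`⟨w,𝒫(s)w⟩ − σ‖w‖² = (1−s)(⟨a,P₀a⟩ − σ‖a‖²) + (⟨u,H₁u⟩ − σ‖u‖²)`, `u = (√s·a, φ)`. [folklore] -/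
theorem coercive_extOpR {σ : ℝ}
    (hP₀ : ∀ a : ιc → ℝ, σ * (a ⬝ᵥ a) ≤ a ⬝ᵥ P₀.mulVec a)
    (hH₁ : ∀ u : ιc ⊕ ιf → ℝ, σ * (u ⬝ᵥ u) ≤ u ⬝ᵥ (fromBlocks A₁ B C D).mulVec u)
    {s : ℝ} (hs0 : 0 ≤ s) (hs1 : s ≤ 1) (w : ιc ⊕ ιf → ℝ) :
    σ * (w ⬝ᵥ w) ≤ w ⬝ᵥ (extOpR P₀ A₁ B C D s).mulVec w := by
  have h0 := hP₀ (w ∘ Sum.inl)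
  have h1 := hH₁ (uvecR s w)
  rw [uvecR_dot_self hs0] at h1
  rw [form₂_extOpR P₀ A₁ B C D hs0, dot_self_sum]
  have ha : 0 ≤ (w ∘ Sum.inl) ⬝ᵥ (w ∘ Sum.inl) := by
    simp only [dotProduct]; exact Finset.sum_nonneg fun _ _ => mul_self_nonneg _
  have h0' : (1 - s) * (σ * ((w ∘ Sum.inl) ⬝ᵥ (w ∘ Sum.inl))) ≤
      (1 - s) * ((w ∘ Sum.inl) ⬝ᵥ P₀.mulVec (w ∘ Sum.inl)) := mul_le_mul_of_nonneg_left h0 (by linarith)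
  nlinarith [ha]

/-- The conjugation-error double sum of a matrix `M` at weight `ρ` is the bilinear form at the weighted pair minus the
plain form: `Σ_{jk}(e^{ρ_j−ρ_k} − 1)M_{jk}w_jw_k = ⟨e^{ρ}w, M e^{−ρ}w⟩ − ⟨w, Mw⟩`. [folklore] -/
theorem conjError_eq {ι : Type*} [Fintype ι] (M : Matrix ι ι ℝ) (ρ w : ι → ℝ) :
    ∑ j, ∑ k, (Real.exp (ρ j - ρ k) - 1) * M j k * (w j * w k) =
      (fun j => Real.exp (ρ j) * w j) ⬝ᵥ M.mulVec (fun k => Real.exp (-ρ k) * w k) - w ⬝ᵥ M.mulVec w := by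
  simp only [dotProduct, mulVec, Finset.mul_sum, ← Finset.sum_sub_distrib]
  refine Finset.sum_congr rfl fun j _ => Finset.sum_congr rfl fun k _ => ?_
  rw [Real.exp_sub, Real.exp_neg]
  have hk : Real.exp (ρ k) ≠ 0 := (Real.exp_pos _).ne'
  field_simp

omit [Fintype ιc] [Fintype ιf] in
/-- Weights commute with the `√s` rescaling: `uvecR s (e^{±ρ}·w) = e^{±ρ}·uvecR s w`. [folklore] -/
theorem uvecR_weight (s : ℝ) (f : ιc ⊕ ιf → ℝ) (w : ιc ⊕ ιf → ℝ) :
    uvecR s (fun i => f i * w i) = fun i => f i * uvecR s w i := by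
  ext i
  rcases i with c | c
  · simp only [uvecR, Sum.elim_inl, Pi.smul_apply, Function.comp_apply, smul_eq_mul]
    ring
  · simp only [uvecR, Sum.elim_inr, Function.comp_apply]

/-- **UNIFORM CONJUGATION-ERROR BOUND**: if the Combes–Thomas conjugation error of `P₀` (weight `ρ ∘ inl`) and of `H₁`
(weight `ρ`) are both `≥ −(σ∕2)‖·‖²`, then so is that of `𝒫(s)` (weight `ρ`) for every `s ∈ [0,1]` — in fact with
EQUALITY `err(𝒫(s), w) = (1−s)·err(P₀, a) + err(H₁, (√s·a, φ))`. [folklore] -/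
theorem conjError_extOpR_ge {σ : ℝ} (ρ : ιc ⊕ ιf → ℝ)
    (h₀ : ∀ a : ιc → ℝ, -(σ / 2) * (a ⬝ᵥ a) ≤
      ∑ j, ∑ k, (Real.exp (ρ (Sum.inl j) - ρ (Sum.inl k)) - 1) * P₀ j k * (a j * a k))
    (h₁ : ∀ u : ιc ⊕ ιf → ℝ, -(σ / 2) * (u ⬝ᵥ u) ≤
      ∑ j, ∑ k, (Real.exp (ρ j - ρ k) - 1) * (fromBlocks A₁ B C D) j k * (u j * u k))
    {s : ℝ} (hs0 : 0 ≤ s) (hs1 : s ≤ 1) (w : ιc ⊕ ιf → ℝ) :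
    -(σ / 2) * (w ⬝ᵥ w) ≤ ∑ j, ∑ k, (Real.exp (ρ j - ρ k) - 1) * extOpR P₀ A₁ B C D s j k * (w j * w k) := by
  have e0 := h₀ (w ∘ Sum.inl)
  have e1 := h₁ (uvecR s w)
  rw [conjError_eq] at e0 e1 ⊢
  rw [form₂_extOpR P₀ A₁ B C D hs0, form₂_extOpR P₀ A₁ B C D hs0, uvecR_weight, uvecR_weight,
    uvecR_dot_self hs0, dot_self_sum] at *
  have ha : 0 ≤ (w ∘ Sum.inl) ⬝ᵥ (w ∘ Sum.inl) := by
    simp only [dotProduct]; exact Finset.sum_nonneg fun _ _ => mul_self_nonneg _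
  have e0' : (1 - s) * (-(σ / 2) * ((w ∘ Sum.inl) ⬝ᵥ (w ∘ Sum.inl))) ≤ (1 - s) *
      ((fun j => Real.exp (ρ (Sum.inl j)) * (w ∘ Sum.inl) j) ⬝ᵥ P₀.mulVec (fun k => Real.exp (-ρ (Sum.inl k)) *
        (w ∘ Sum.inl) k) - (w ∘ Sum.inl) ⬝ᵥ P₀.mulVec (w ∘ Sum.inl)) := mul_le_mul_of_nonneg_left e0 (by linarith)
  have hcomp : ∀ g : ιc ⊕ ιf → ℝ, ((fun i => g i * w i) ∘ Sum.inl) = fun j => g (Sum.inl j) * (w ∘ Sum.inl) j :=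
    fun g => rfl
  simp only [hcomp] at *
  nlinarith [ha, mul_nonneg hs0 ha]

end Form

/-! ### §3 Invertibility, the block inverse, the FORM-VERSION DECAY uniformly in `s` -/

section Main

variable [Fintype ιc] [Fintype ιf] [DecidableEq ιc] [DecidableEq ιf]

/-- A coercive real matrix (`σ > 0`) has `IsUnit det`. [folklore] -/
theorem isUnit_det_of_coercive {ι : Type*} [Fintype ι] [DecidableEq ι] (M : Matrix ι ι ℝ) {σ : ℝ} (hσ : 0 < σ)
    (hpos : ∀ ω : ι → ℝ, σ * (ω ⬝ᵥ ω) ≤ ω ⬝ᵥ M.mulVec ω) : IsUnit M.det := by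
  rw [isUnit_iff_ne_zero, Ne, ← Matrix.exists_mulVec_eq_zero_iff]
  rintro ⟨x, hx, hMx⟩
  have h1 := hpos x
  rw [hMx, dotProduct_zero] at h1
  have h2 : 0 < x ⬝ᵥ x := by
    obtain ⟨j₀, hj₀⟩ := Function.ne_iff.mp hx
    have : x j₀ * x j₀ ≤ x ⬝ᵥ x :=
      Finset.single_le_sum (f := fun i => x i * x i) (fun i _ => mul_self_nonneg _) (Finset.mem_univ j₀)
    exact lt_of_lt_of_le (mul_self_pos.mpr hj₀) this
  nlinarith

omit [DecidableEq ιc] in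
/-- The fine block `D` of a coercive `H₁` is invertible (test on `(0, φ)`). [folklore] -/
theorem isUnit_det_fineR {σ : ℝ} (hσ : 0 < σ)
    (hH₁ : ∀ u : ιc ⊕ ιf → ℝ, σ * (u ⬝ᵥ u) ≤ u ⬝ᵥ (fromBlocks A₁ B C D).mulVec u) : IsUnit D.det := by
  refine isUnit_det_of_coercive D hσ fun φ => ?_
  have h := hH₁ (Sum.elim 0 φ)
  simpa only [dotProduct, fromBlocks_mulVec, Fintype.sum_sum_type, Sum.elim_inl, Sum.elim_inr, Sum.elim_comp_inl,
    Sum.elim_comp_inr, Pi.zero_apply, zero_mul, Finset.sum_const_zero, zero_add, mulVec_zero, Pi.add_apply,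
    mul_zero] using h

/-- Invertibility passes from `𝒫(s)` to the line (fine block invertible). [folklore] -/
theorem isUnit_det_lineOpR_of_extOpR {s : ℝ} (hs : 0 ≤ s) (hD : IsUnit D.det)
    (hE : IsUnit (extOpR P₀ A₁ B C D s).det) : IsUnit (lineOpR P₀ A₁ B C D s).det := by
  letI := invertibleOfIsUnitDet D hD
  have h1 : IsUnit (extOpR P₀ A₁ B C D s) := (Matrix.isUnit_iff_isUnit_det _).mpr hE
  rw [extOpR, isUnit_fromBlocks_iff_of_invertible₂₂, invOf_eq_nonsing_inv, schur_extOpR P₀ A₁ B C D hs] at h1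
  exact (Matrix.isUnit_iff_isUnit_det _).mp h1

/-- **BLOCK INVERSE**: the coarse–coarse block of `𝒫(s)⁻¹` is `G(s) = P(s)⁻¹`. [folklore] -/
theorem inv_extOpR_inl_inl {s : ℝ} (hs : 0 ≤ s) (hD : IsUnit D.det) (hS : IsUnit (lineOpR P₀ A₁ B C D s).det)
    (x y : ιc) : (extOpR P₀ A₁ B C D s)⁻¹ (Sum.inl x) (Sum.inl y) = (lineOpR P₀ A₁ B C D s)⁻¹ x y := by
  letI := invertibleOfIsUnitDet D hD
  have hS' : IsUnit (((1 - s) • P₀ + s • A₁) - (Real.sqrt s • B) * ⅟D * (Real.sqrt s • C)).det := by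
    rwa [invOf_eq_nonsing_inv, schur_extOpR P₀ A₁ B C D hs]
  letI := invertibleOfIsUnitDet _ hS'
  letI := fromBlocks₂₂Invertible ((1 - s) • P₀ + s • A₁) (Real.sqrt s • B) (Real.sqrt s • C) D
  rw [extOpR, ← invOf_eq_nonsing_inv (fromBlocks _ _ _ _), invOf_fromBlocks₂₂_eq, fromBlocks_apply₁₁,
    invOf_eq_nonsing_inv, invOf_eq_nonsing_inv, schur_extOpR P₀ A₁ B C D hs]

/-- **K1-lin(s), FORM VERSION — UNIFORM-IN-`s` WEIGHTED DECAY OF THE INTERPOLATED-SCHUR PROPAGATOR.**  Let `P₀` and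
`H₁ = [[A₁,B],[C,D]]` be `σ`-coercive (`σ > 0`) and let the weight `ρ` on coarse ⊕ fine have Combes–Thomas conjugation
error `≥ −(σ∕2)‖·‖²` against both `P₀` (restricted weight) and `H₁`.  Then for EVERY `s ∈ [0,1]` the line
`P(s) = (1−s)P₀ + s(A₁ − BD⁻¹C)` is invertible and `|P(s)⁻¹(x,y)| ≤ (2∕σ)·e^{−(ρ(inl x) − ρ(inl y))}` — the constant
and the admissible weight class independent of `s` (tree `Beta.CombesThomasForm.combesThomas_form` on `𝒫(s)`, then the
block inverse). [folklore] -/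
theorem lineOpR_inv_decay_form {σ : ℝ} (hσ : 0 < σ) (ρ : ιc ⊕ ιf → ℝ)
    (hP₀ : ∀ a : ιc → ℝ, σ * (a ⬝ᵥ a) ≤ a ⬝ᵥ P₀.mulVec a)
    (hH₁ : ∀ u : ιc ⊕ ιf → ℝ, σ * (u ⬝ᵥ u) ≤ u ⬝ᵥ (fromBlocks A₁ B C D).mulVec u)
    (h₀ : ∀ a : ιc → ℝ, -(σ / 2) * (a ⬝ᵥ a) ≤
      ∑ j, ∑ k, (Real.exp (ρ (Sum.inl j) - ρ (Sum.inl k)) - 1) * P₀ j k * (a j * a k))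
    (h₁ : ∀ u : ιc ⊕ ιf → ℝ, -(σ / 2) * (u ⬝ᵥ u) ≤
      ∑ j, ∑ k, (Real.exp (ρ j - ρ k) - 1) * (fromBlocks A₁ B C D) j k * (u j * u k))
    {s : ℝ} (hs0 : 0 ≤ s) (hs1 : s ≤ 1) :
    IsUnit (lineOpR P₀ A₁ B C D s).det ∧
      ∀ x y : ιc, |(lineOpR P₀ A₁ B C D s)⁻¹ x y| ≤ 2 / σ * Real.exp (-(ρ (Sum.inl x) - ρ (Sum.inl y))) := by
  have hposE := coercive_extOpR P₀ A₁ B C D hP₀ hH₁ hs0 hs1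
  have herrE := conjError_extOpR_ge P₀ A₁ B C D ρ h₀ h₁ hs0 hs1
  have hdetE : IsUnit (extOpR P₀ A₁ B C D s).det := isUnit_det_of_coercive _ hσ hposE
  have hD : IsUnit D.det := isUnit_det_fineR A₁ B C D hσ hH₁
  have hL : IsUnit (lineOpR P₀ A₁ B C D s).det := isUnit_det_lineOpR_of_extOpR P₀ A₁ B C D hs0 hD hdetE
  refine ⟨hL, fun x y => ?_⟩
  have hv : (extOpR P₀ A₁ B C D s).mulVec ((extOpR P₀ A₁ B C D s)⁻¹.mulVec (Pi.single (Sum.inl y) 1)) =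
      Pi.single (Sum.inl y) 1 := by
    rw [Matrix.mulVec_mulVec, Matrix.mul_nonsing_inv _ hdetE, Matrix.one_mulVec]
  have h := Literature.MathematicalPhysics.QuantumFieldTheory.Balaban1983to89.Beta.CombesThomasForm.combesThomas_form
    (extOpR P₀ A₁ B C D s) σ ρ hσ hposE herrE (Sum.inl y) _ hv (Sum.inl x)
  rwa [Matrix.mulVec_single_one, Matrix.col_apply, inv_extOpR_inl_inl P₀ A₁ B C D hs0 hD hL] at h

end Main

end Summit.QuantumFields.BalabanUV.T4Continuum.NE7K1LinSchurLineForm
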